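import Summits.Ventures.PercRepro.Night2LocalD3ThreeTwoTrace

/-!
# PercRepro — the cell `(a, k) = (3, 2)` at `|E ∖ G| = 3`, `q = 4`: the loads at the far sets with `S ∖ x ∈ U_G` (night-2, gen 13)

Sequel of `Night2LocalD3ThreeTwoC.lean` / `Night2LocalD3ThreeTwoTrace.lean`.  The bookkeeping of the distance-2 rule at a far set
`S` with `coloops S = K ∪ {x}` and non-coloops `T = {w₁, w₂, w₃}`, in terms of the candidates `cand w = insert w (coloops S)`:

* the loss fraction is bounded by `(L − 2/5)⁺ / L` once the layer-1 request is `≤ L` and the capacity is `≥ 2/5`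
  (`loss_le_req_mul_lossFrac`; this bound is monotone in `L`, `lossFrac_mono`);
* the covering set `S ∖ x` is the only layer-1 preimage of `S` (`L1_le_req_erase`), so `cap₂(S) ≥ 2/5 − req(S ∖ x)`
  (`cap2_ge_of_three_two`);
* requests: `req B ≤ req B'` for `B ⊆ B'` (`req_le_req_of_subset`), `req B ≤ (6/5)/(n + 3)` when `|G ∖ cl B| ≥ n`
  (`req_le_of_le_card`); the capacity left by layer 0 is `≥ 2/5` at every subset of `G` (`two_fifths_le_capS`).
The preimages of `S ∖ v` and the candidates' layer-2 weights are in `Night2LocalD3ThreeTwoPre.lean`; the arithmetic and the assembly in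
`Night2LocalD3ThreeTwoE.lean`.
-/

open scoped Matroid

namespace PercRepro.Shadow

open Finset PerFlat ThmH

variable {α : Type*} [DecidableEq α] {M : Matroid α} [M.Finite]

/-! ## The loss-fraction bound `(L − 2/5)⁺ / L` -/

omit [DecidableEq α] [M.Finite] in
/-- The loss fraction `(L − 2/5)⁺ / L` is nonnegative. -/
theorem lossFrac_nonneg (L : ℚ) : 0 ≤ (if L ≤ 2 / 5 then (0 : ℚ) else (L - 2 / 5) / L) := by
  split_ifs with h
  · exact le_refl _
  · push Not at h
    exact div_nonneg (by linarith) (by linarith)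

omit [DecidableEq α] [M.Finite] in
/-- The loss fraction `(L − 2/5)⁺ / L` is monotone in `L`. -/
theorem lossFrac_mono {L L' : ℚ} (h : L ≤ L') :
    (if L ≤ 2 / 5 then (0 : ℚ) else (L - 2 / 5) / L) ≤ (if L' ≤ 2 / 5 then (0 : ℚ) else (L' - 2 / 5) / L') := by
  split_ifs with h1 h2 h2
  · exact le_refl _
  · push Not at h2
    exact div_nonneg (by linarith) (by linarith)
  · push Not at h1
    linarith
  · push Not at h1 h2
    have hL : 0 < L := by linarith
    have hL' : 0 < L' := by linarith
    rw [sub_div, sub_div, div_self hL.ne', div_self hL'.ne']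
    have : (2 / 5 : ℚ) / L' ≤ (2 / 5) / L := div_le_div_of_nonneg_left (by norm_num) hL h
    linarith

section Loads

variable {G S : Finset α}

/-- **The loss bound**: with `L₁(B ∪ {z}) ≤ L` and `capS(B ∪ {z}) ≥ 2/5`, the loss of `B` at `B ∪ {z}` is at most `req B · lam L`. -/
theorem loss_le_req_mul_lossFrac {B : Finset α} {z : α} {L : ℚ} (hL : L1 M 4 G (insert z B) ≤ L)
    (hcap : 2 / 5 ≤ capS M 4 G (insert z B)) :
    loss M 4 G B z ≤ req M 4 B * (if L ≤ 2 / 5 then (0 : ℚ) else (L - 2 / 5) / L) := by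
  split_ifs with hle
  · unfold loss fS
    rw [if_pos (hL.trans (hle.trans hcap))]
    simp
  · push Not at hle
    exact loss_le_of_L1_le hL hcap (by norm_num) hle.le

/-- With two coloops of `M|G` the capacity left by layer 0 is at least `2/5` at every subset of `G`. -/
theorem two_fifths_le_capS (hd : (gr M \ G).card = 3) (hk : kColoops M G = 2) {S' : Finset α} (hS' : S' ⊆ G) :
    2 / 5 ≤ capS M 4 G S' := by
  have hk1 : k1 M 4 G S' ≤ 2 := hk ▸ k1_le_kColoops hS'
  have hcapS : capS M 4 G S' = 1 - (k1 M 4 G S' : ℚ) * (3 / 10) := by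
    unfold capS; rw [hd]; unfold phiQ; push_cast; ring
  rw [hcapS]
  have : (k1 M 4 G S' : ℚ) ≤ 2 := by exact_mod_cast hk1
  linarith

/-- `req B ≤ req B'` for `B ⊆ B'` when some ground element lies outside `cl B'`. -/
theorem req_le_req_of_subset {q : ℕ} {B B' : Finset α} (hBB' : B ⊆ B') {e : α} (he : e ∈ gr M \ clF M B') :
    req M q B ≤ req M q B' := by
  unfold req
  have hsub : gr M \ clF M B' ⊆ gr M \ clF M B := Finset.sdiff_subset_sdiff (le_refl _) (clF_mono hBB')
  have hpos : (0 : ℚ) < ((gr M \ clF M B').card : ℚ) := by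
    exact_mod_cast Finset.card_pos.2 ⟨e, he⟩
  apply div_le_div_of_nonneg_left (phiQ_pos q).le hpos
  exact_mod_cast Finset.card_le_card hsub

/-- `req B ≤ (6/5)/(n + 3)` for a member inside `G` with `|G ∖ cl B| ≥ n`, at `|E ∖ G| = 3`, `q = 4`. -/
theorem req_le_of_le_card (hG : G ∈ flatsQ M (4 + 1)) (hd : (gr M \ G).card = 3) {B : Finset α}
    (hBG : clF M B ⊆ G) {n : ℕ} (hm : n ≤ (G \ clF M B).card) : req M 4 B ≤ (6 / 5) / ((n : ℚ) + 3) := by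
  have hc : (gr M \ clF M B).card = (G \ clF M B).card + 3 := by rw [card_compl_clF_add hG hBG, hd]
  unfold req
  have hphi : phiQ 4 = 6 / 5 := by unfold phiQ; norm_num
  rw [hphi]
  have hn : (n : ℚ) + 3 ≤ ((gr M \ clF M B).card : ℚ) := by
    rw [hc]; push_cast
    have : (n : ℚ) ≤ ((G \ clF M B).card : ℚ) := by exact_mod_cast hm
    linarith
  apply div_le_div_of_nonneg_left (by norm_num) (by positivity) hn

open scoped Classical in
/-- **`S ∖ x` is the only layer-1 preimage of `S`** (`coloops S = K ∪ {x}`; the preimages `S ∖ y`, `y ∈ K`, are layer-0):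
`L₁(S) ≤ req(S ∖ x)`. -/
theorem L1_le_req_erase (hG : G ∈ flatsQ M (4 + 1)) (hd : (gr M \ G).card = 3)
    (hS : S ∈ shadowAt M (4 + 2) 4 (Uq M (4 + 2) 4) G) {x : α}
    (hcol : coloops M S = insert x (G.filter (fun y => y ∉ clF M (G.erase y)))) :
    L1 M 4 G S ≤ req M 4 (S.erase x) := by
  set K := G.filter (fun y => y ∉ clF M (G.erase y)) with hKdef
  have hGg : G ⊆ gr M := (mem_flatsQ.1 hG).1
  have hSG : S ⊆ G := subset_of_mem_shadowAt hS
  have hsub : (coverPreimages M (Uq M (4 + 2) 4) G S).filter (fun B => B ∉ lay0 M 4 G) ⊆ {S.erase x} := by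
    intro B' hB'
    rw [Finset.mem_filter, mem_coverPreimages, mem_coverSets] at hB'
    obtain ⟨⟨hB'm, z, hz, hzS⟩, hB'0⟩ := hB'
    have hB'U : B' ∈ Uq M (4 + 2) 4 := (mem_membersIn.1 hB'm).1
    have hzB' : z ∉ B' := fun h => (Finset.mem_sdiff.1 hz).2 (subset_clF hB'U h)
    have hB'eq : B' = S.erase z := by rw [← hzS, Finset.erase_insert hzB']
    have hzcol : z ∈ coloops M S := by
      rw [mem_coloops]
      refine ⟨by rw [← hzS]; exact Finset.mem_insert_self _ _, ?_⟩
      rw [← hB'eq]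
      exact (Finset.mem_sdiff.1 hz).2
    rw [hcol, Finset.mem_insert] at hzcol
    rw [Finset.mem_singleton]
    rcases hzcol with rfl | hzK
    · exact hB'eq
    · exfalso
      apply hB'0
      rw [mem_lay0]
      refine ⟨hB'm, ?_, by omega⟩
      have hzG : z ∈ G := (Finset.mem_filter.1 hzK).1
      have hzcl : z ∉ clF M (G.erase z) := (Finset.mem_filter.1 hzK).2
      have hzcolG : z ∈ coloops M G := Finset.mem_filter.2 ⟨hzG, hzcl⟩
      have hrGz : rkN M (G.erase z) = 4 := by
        have := rkN_erase_of_mem_coloops hGg hzcolG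
        have hGr : rkN M G = 4 + 1 := by
          have h := (mem_flatsQ.1 hG).2.2
          rw [eRk_eq_rkN] at h
          exact_mod_cast h
        omega
      have hrB' : rkN M B' = 4 := by
        have h := (mem_Uq.1 hB'U).2.1
        rw [eRk_eq_rkN] at h
        exact_mod_cast h
      have hB'sub : B' ⊆ G.erase z := by
        rw [hB'eq]
        exact Finset.erase_subset_erase z hSG
      have hGz : G.erase z ⊆ clF M B' := by
        have h := subset_closure_of_rkN_eq ((Finset.erase_subset z G).trans hGg) hB'sub (by omega)
        intro e he
        rw [← Finset.mem_coe, coe_clF]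
        exact h (by exact_mod_cast he)
      have hGsub : G \ clF M B' ⊆ {z} := by
        intro e he
        rw [Finset.mem_sdiff] at he
        rw [Finset.mem_singleton]
        by_contra hne
        exact he.2 (hGz (Finset.mem_erase.2 ⟨hne, he.1⟩))
      have h1 : (G \ clF M B').card ≤ 1 := (Finset.card_le_card hGsub).trans (by simp)
      have h2 : 1 ≤ (G \ clF M B').card := Finset.card_pos.2 ⟨z, hz⟩
      omega
  unfold L1
  calc ∑ B ∈ (coverPreimages M (Uq M (4 + 2) 4) G S).filter (fun B => B ∉ lay0 M 4 G), req M 4 B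
      ≤ ∑ B ∈ ({S.erase x} : Finset (Finset α)), req M 4 B :=
        Finset.sum_le_sum_of_subset_of_nonneg hsub (fun B _ _ => req_nonneg 4 B)
    _ = req M 4 (S.erase x) := Finset.sum_singleton _ _

open scoped Classical in
/-- `cap₂(S) ≥ 2/5 − req(S ∖ x)` at a far set with `coloops S = K ∪ {x}`. -/
theorem cap2_ge_of_three_two (hG : G ∈ flatsQ M (4 + 1)) (hd : (gr M \ G).card = 3) (hk : kColoops M G = 2)
    (hS : S ∈ shadowAt M (4 + 2) 4 (Uq M (4 + 2) 4) G) {x : α}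
    (hcol : coloops M S = insert x (G.filter (fun y => y ∉ clF M (G.erase y)))) :
    2 / 5 - req M 4 (S.erase x) ≤ cap2 M 4 G S := by
  have hSG : S ⊆ G := subset_of_mem_shadowAt hS
  have hcap := two_fifths_le_capS hd hk hSG
  have h1 := cap2_ge_capS_sub_L1 (M := M) (q := 4) (G := G) (S := S) (by linarith)
  have h2 := L1_le_req_erase hG hd hS hcol
  linarith

end Loads

end PercRepro.Shadow
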